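import Summits.QuantumFields.YangMills.Theorems.FluctuationComparisonRegPrIntLWregInteriorRungs
import Summits.QuantumFields.YangMills.Theorems.FluctuationComparisonRegPrIntLWregDescendChart
import Literature.MathematicalPhysics.QuantumFieldTheory.Balaban1983to89.T4QuatExpLog
import HarnessLib

/-!
# Organ WREG (crux `FluctuationComparisonRegPrIntL`, stmt-QuantumFields-20520), PORT FILE F5 «ASSEMBLY»: §4d CHART DATA (the canonical fibred chart of
# `descendTo` on `histGood` with its image windows — `histGood_subset_charted`, `structure ChartData`, `nonempty_chartData`, `exists_chartData_bdd`,
# `WindowChart.ofChartData`, `exists_gamma_levelRegime`) and §4e THE CHART-FREE RE-CUT OF CHART: VOL + EDGE + LEVEL + CHARGE ⇒ `WindowChartsExist`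
# (`isOpen_setOf_plaqSmall₂`, `card_Idx_T3`, `exists_chartRegime`, ★ `windowChartsExist_of_flat`) — v20 ll. 2203–2338 and 2393–2547 VERBATIM
# (the four obligation defs of §4e live in F4a `…WregInterior`)

Cell `ym3-torus` (YM ladder rung R3 = continuum SU(2) Yang–Mills on the three-torus — a RUNG, NOT the Clay problem: not d = 4, not
infinite volume, not a mass gap); WIDTH helper seat `ym3-torus-px7` gen 8 (★★OWNER WORD 33: F5 := px7 g8); `--supports stmt-QuantumFields-20520`
(helper).  A PORT proves nothing new: every declaration below is a VERBATIM move of a proved declaration of the Cruxes workfile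
`Summits/QuantumFields/YangMills/Cruxes/FluctuationComparisonRegPrIntL/Lines/wreg_chart.lean` v20 (ideator ym-r3-idea-1 g18; PORT MAP
`Lines/wreg_chart_port.md` @7bd96d90, file F5), with the namespace `Summit.QuantumFields.YangMills.Cruxes.FluctuationComparisonRegPrIntL.RunPairOrgan.
WregChart` swapped for this file's.  WREG is one organ of S2β; crux stmt-QuantumFields-20520 is NOT closed by the port; `YM3TorusSU2` NOT proved;
YM gap NOT proved.

Adapted from `Cruxes/FluctuationComparisonRegPrIntL/Lines/wreg_chart.lean` v20 §4d + §4e.  Imports: F4b `…WregInteriorRungs` (px17 g6; brings F4a `…WregInterior`, F3 `…WregGlue`, F1 `…WregChain`∕`…WregChainLaw` and the T³ tower) + F2c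
`…WregDescendChart` (px11 g8; `exists_chartData_descendTo_reg`, `chainWindow_extend` via F2a — px17's F4 does not import F2) + lit `T4QuatExpLog`; nothing whose closure contains
`T4Continuum.Support.SubstrateBackground` (port-map HAZARD: the instance-sensitive proof v17 :2489 lives in this file and elaborates by import order alone).
The consumer is F6 `…Wreg` (w3-20520 g13): `windowRegularity_of_chart (windowChartsExist_of_flat …) windowFibreInterior_holds`.
-/

noncomputable section

open MeasureTheory Filter Topology Set
open scoped ENNReal NNReal
open Literature.MathematicalPhysics.QuantumFieldTheory.Balaban1983to89
open Literature.MathematicalPhysics.QuantumFieldTheory.Balaban1983to89.T3ContinuumYM3Torus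
open Literature.MathematicalPhysics.QuantumFieldTheory.Balaban1983to89.T3NestedUnitLaws
open Literature.MathematicalPhysics.QuantumFieldTheory.Balaban1983to89.T3UnitLawDensityEML
open Literature.MathematicalPhysics.QuantumFieldTheory.Balaban1983to89.T3UnitScaleTilt
open Literature.MathematicalPhysics.QuantumFieldTheory.Balaban1983to89.T3TiltDescent
open Literature.MathematicalPhysics.QuantumFieldTheory.Balaban1983to89.T3PrintedRegularMinimiser
open Literature.MathematicalPhysics.QuantumFieldTheory.Balaban1983to89.T3ConstrainedMinimiser (fibre)
open Literature.MathematicalPhysics.QuantumFieldTheory.Balaban1983to89.T3LevelShift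
open Literature.MathematicalPhysics.QuantumFieldTheory.Balaban1983to89.T3SmallLiftHistory
open Literature.MathematicalPhysics.QuantumFieldTheory.Balaban1983to89.T3Thresholds
open Literature.MathematicalPhysics.QuantumFieldTheory.Balaban1983to89.Missing
open Literature.MathematicalPhysics.QuantumFieldTheory.Balaban1983to89.T4Continuum
open scoped Literature.MathematicalPhysics.QuantumFieldTheory.Balaban1983to89.T3OrbitAverage

namespace Summit.QuantumFields.YangMills.Theorems.FluctuationComparisonRegPrIntLWregAssembly

open Summit.QuantumFields.YangMills.Theorems.FluctuationComparisonRegPrIntLWregChain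
open Summit.QuantumFields.YangMills.Theorems.FluctuationComparisonRegPrIntLWregFibredChart
open Summit.QuantumFields.YangMills.Theorems.FluctuationComparisonRegPrIntLWregGlue
open Summit.QuantumFields.YangMills.Theorems.FluctuationComparisonRegPrIntLWregInterior

/-! ## §4d CHART DATA (v10): the canonical fibred chart of `descendTo` on `histGood` with its image windows; `regular` from EDGE + LEVEL flatness -/

section ChartDataSec

open Literature.MathematicalPhysics.QuantumFieldTheory.Balaban1983to89.ExpMeanLog (deltaSU)
open Literature.MathematicalPhysics.QuantumFieldTheory.Balaban1983to89.BlockAveraging (Idx)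
open Literature.MathematicalPhysics.QuantumFieldTheory.Balaban1983to89.BlockAveragingEMLHaarAC (offCard)

/-- `histGood` lies in the charted set once `(((d+2)L)²/4)·θ(i) ≤ α`. [cite: Balaban1985UV3, (7) p.257] -/
theorem histGood_subset_charted (F : T3Family) {J K : ℕ} (hJK : J ≤ K) {θ : ℕ → ℝ} (hθ0 : ∀ i, 0 ≤ θ i) {α : ℝ}
    (hθα : ∀ i, (((((F.P K).d + 2) * (F.P K).L : ℕ) : ℝ) ^ 2 / 4) * θ i ≤ α) :
    histGood F ℰp θ K J ⊆ {U | ∀ c, U (iterCentralBond (K - J) c) ∈ chainWindow (N := 2) α (K - J) U c} := by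
  intro U hU c
  have hn : K - J ≤ (F.P K).m + (F.P K).K := by
    show K - J ≤ F.m + K
    omega
  exact self_mem_chainWindow (N := 2) (fun k => θ (K - k)) (fun k => hθ0 _) (fun k => hθα _) hn U c fun k hk => hU k (by omega)

/-- **CHART DATA** of `descendTo` on `Sfine` over `O`. [cite: Balaban1987RG1, (0.4) p.253, (2.4) p.266 and (2.10) p.267] -/
structure ChartData (F : T3Family) {J K : ℕ} (hJK : J ≤ K) (α : ℝ) (Sfine : Set (GaugeField (F.P K) 0 (Matrix.specialUnitaryGroup (Fin 2) ℂ)))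
    (O : Set (GaugeField (F.P J) 0 (Matrix.specialUnitaryGroup (Fin 2) ℂ))) where
  /-- the chart map -/
  Φ : GaugeField (F.P J) 0 (Matrix.specialUnitaryGroup (Fin 2) ℂ) × GaugeField (F.P K) 0 (Matrix.specialUnitaryGroup (Fin 2) ℂ) →
    GaugeField (F.P K) 0 (Matrix.specialUnitaryGroup (Fin 2) ℂ)
  /-- its Jacobian -/
  jac : GaugeField (F.P J) 0 (Matrix.specialUnitaryGroup (Fin 2) ℂ) × GaugeField (F.P K) 0 (Matrix.specialUnitaryGroup (Fin 2) ℂ) → ℝ≥0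
  /-- the closed image windows of the pivot coordinates -/
  T : PBond (F.P K) (K - J) → GaugeField (F.P K) 0 (Matrix.specialUnitaryGroup (Fin 2) ℂ) → Set (Matrix.specialUnitaryGroup (Fin 2) ℂ)
  /-- the pivot relabelling: `(fieldShift⁻¹ V) c = V (w c)` -/
  w : PBond (F.P K) (K - J) → PBond (F.P J) 0
  measurable_Φ : Measurable Φ
  measurable_jac : Measurable jac
  descendTo_Φ : ∀ V z, jac (V, z) ≠ 0 → descendTo F ℰp J K hJK (Φ (V, z)) = V
  mem_of_ne_zero : ∀ V z, jac (V, z) ≠ 0 → Φ (V, z) ∈ Sfine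
  map_Φ : (fieldMeasure (F.P K) 0 (Matrix.specialUnitaryGroup (Fin 2) ℂ)).restrict (descendTo F ℰp J K hJK ⁻¹' O ∩ Sfine) =
    ((((fieldMeasure (F.P J) 0 (Matrix.specialUnitaryGroup (Fin 2) ℂ)).restrict O).prod
        (fieldMeasure (F.P K) 0 (Matrix.specialUnitaryGroup (Fin 2) ℂ))).withDensity (fun p => (jac p : ℝ≥0∞))).map Φ
  isClosed_T : ∀ c z, IsClosed (T c z)
  ne_zero_iff : ∀ V z, jac (V, z) ≠ 0 ↔ (∀ c, V (w c) ∈ T c z) ∧ Φ (V, z) ∈ Sfine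
  continuousAt_of_interior : ∀ V₀ z, (∀ c, V₀ (w c) ∈ interior (T c z)) → Φ (V₀, z) ∉ frontier Sfine →
    ContinuousAt (fun V => Φ (V, z)) V₀ ∧ ContinuousAt (fun V => jac (V, z)) V₀
  eventually_eq_zero : ∀ V₀ z, (∃ c, V₀ (w c) ∉ closure (T c z)) → ∀ᶠ V in 𝓝 V₀, jac (V, z) = 0
  /-- the image windows ARE the images of the iterated central `α`-windows under the chain maps (chart-free description) -/
  T_eq : ∀ c z, T c z = chainMap ℰp (K - J) z c '' chainWindow (N := 2) α (K - J) z c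
  /-- at a raw-live point the chart value keeps the off-pivot coordinates of `z`, is charted, and descends to `V` -/
  charted : ∀ V z, (∀ c, V (w c) ∈ T c z) → (∀ b, (∀ c, iterCentralBond (K - J) c ≠ b) → Φ (V, z) b = z b) ∧
    (∀ c, Φ (V, z) (iterCentralBond (K - J) c) ∈ chainWindow (N := 2) α (K - J) (Φ (V, z)) c) ∧
    descendTo F ℰp J K hJK (Φ (V, z)) = V
  /-- RECOGNITION: a charted fine field in `Sfine` with off-pivot coordinates `z` descending to `V` is the chart value at … -/
  recog : ∀ V z (g : PBond (F.P K) (K - J) → Matrix.specialUnitaryGroup (Fin 2) ℂ), (∀ c, g c ∈ chainWindow (N := 2) α (K - J) z c) →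
    Function.extend (iterCentralBond (K - J)) g z ∈ Sfine →
    descendTo F ℰp J K hJK (Function.extend (iterCentralBond (K - J)) g z) = V →
    jac (V, z) ≠ 0 ∧ Φ (V, z) = Function.extend (iterCentralBond (K - J)) g z

/-- ★★★ **CHART DATA EXIST AT EVERY DEPTH ON `histGood`** (PROVED from VOL + EDGE + LEVEL + CHARGE). [cite: Balaban1987RG1, (0.4) p.253, (2.4) p.266 and (2.10) p.267] -/
theorem nonempty_chartData (F : T3Family) {J K : ℕ} (hJK : J ≤ K) {θ : ℕ → ℝ} (hθ0 : ∀ i, 0 ≤ θ i) {α : ℝ} (hα0 : 0 ≤ α) (hα24 : α ≤ 1 / 24)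
    (hα64 : 64 * α ≤ deltaSU (Fin 2)) (hαL : 157 * α < (((F.P K).L : ℝ) ^ ((F.P K).d - 1))⁻¹)
    (hgap : ∀ j (c : PBond (F.P K) (j + 1)), (offCard c : ℝ) / (Fintype.card (Idx (F.P K)) : ℝ) + 150 * α < 1)
    (hθα : ∀ i, (((((F.P K).d + 2) * (F.P K).L : ℕ) : ℝ) ^ 2 / 4) * θ i ≤ α)
    {O : Set (GaugeField (F.P J) 0 (Matrix.specialUnitaryGroup (Fin 2) ℂ))} (hO : MeasurableSet O) :
    Nonempty (ChartData F hJK α (histGood F ℰp θ K J) O) := by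
  obtain ⟨Φ, jac, T, w, hΦ, hjac, hfib, hmem, hlaw, hTc, hne, hreg, hdead, hTeq, hch, -, hrec⟩ :=
    exists_chartData_descendTo_reg (N := 2) F hJK hα0 hα24 hα64 hαL hgap (j₀ := 0) (Or.inl rfl)
      (measurableSet_histGood F ℰp measurableE_ℰp θ K J) (histGood_subset_charted F hJK hθ0 hθα)
  exact ⟨⟨Φ, jac, T, w, hΦ, hjac, hfib, hmem, hlaw O hO, hTc, hne, hreg, hdead, hTeq, hch, hrec⟩⟩

/-- ★★★ **BOUNDED CHART DATA UNDER CHART-VOL**. [cite: Balaban1987RG1, (0.4) p.253 and (2.10) p.267] -/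
theorem exists_chartData_bdd (F : T3Family) {J K : ℕ} (hJK : J ≤ K) {θ : ℕ → ℝ} (hθ0 : ∀ i, 0 ≤ θ i) {α : ℝ} (hα0 : 0 ≤ α) (hα24 : α ≤ 1 / 24)
    (hα64 : 64 * α ≤ deltaSU (Fin 2)) (hαL : 157 * α < (((F.P K).L : ℝ) ^ ((F.P K).d - 1))⁻¹)
    (hgap : ∀ j (c : PBond (F.P K) (j + 1)), (offCard c : ℝ) / (Fintype.card (Idx (F.P K)) : ℝ) + 150 * α < 1)
    (hθα : ∀ i, (((((F.P K).d + 2) * (F.P K).L : ℕ) : ℝ) ^ 2 / 4) * θ i ≤ α) {j₀ : ℝ≥0} (hj₀ : 0 < j₀) (hvol : ChainVol (F.P K) 2 α j₀)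
    {O : Set (GaugeField (F.P J) 0 (Matrix.specialUnitaryGroup (Fin 2) ℂ))} (hO : MeasurableSet O) :
    ∃ D : ChartData F hJK α (histGood F ℰp θ K J) O, ∀ p, D.jac p ≤ (j₀ ^ ((K - J) * Fintype.card (PBond (F.P K) (K - J))))⁻¹ := by
  obtain ⟨Φ, jac, T, w, hΦ, hjac, hfib, hmem, hlaw, hTc, hne, hreg, hdead, hTeq, hch, hbdd, hrec⟩ :=
    exists_chartData_descendTo_reg (N := 2) F hJK hα0 hα24 hα64 hαL hgap (Or.inr hvol)
      (measurableSet_histGood F ℰp measurableE_ℰp θ K J) (histGood_subset_charted F hJK hθ0 hθα)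
  refine ⟨⟨Φ, jac, T, w, hΦ, hjac, hfib, hmem, hlaw O hO, hTc, hne, hreg, hdead, hTeq, hch, hrec⟩, fun p => ?_⟩
  have hq : j₀ ^ ((K - J) * Fintype.card (PBond (F.P K) (K - J))) ≠ 0 := pow_ne_zero _ hj₀.ne'
  rw [NNReal.le_inv_iff_mul_le hq, mul_comm]
  exact hbdd p

/-- ★★ **`regular` FROM EDGE + LEVEL FLATNESS** — a window chart from chart data. [cite: Balaban1987RG1, (2.10) p.267] -/
def WindowChart.ofChartData {F : T3Family} {J K : ℕ} {hJK : J ≤ K} {θ : ℕ → ℝ} {O : Set (GaugeField (F.P J) 0 (Matrix.specialUnitaryGroup (Fin 2) ℂ))}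
    {α : ℝ} (D : ChartData F hJK α (histGood F ℰp θ K J) O) {δ' : ℝ} (hδ' : 0 ≤ δ') (hθ : ∀ i, θ i < δ')
    (hsmall : (((((F.P K).d + 2) * (F.P K).L : ℕ) : ℝ) ^ 2 / 4) * δ' ≤ ExpMeanLog.deltaSU (Fin 2) / 2)
    (bound : ℝ≥0) (jac_le : ∀ p, D.jac p ≤ bound)
    (edge : ∀ V₀ ∈ O, ∀ᵐ z ∂fieldMeasure (F.P K) 0 (Matrix.specialUnitaryGroup (Fin 2) ℂ),
      (∀ c, V₀ (D.w c) ∈ interior (D.T c z)) ∨ (∃ c, V₀ (D.w c) ∉ closure (D.T c z)))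
    (level : ∀ V₀ ∈ O, ∀ᵐ z ∂fieldMeasure (F.P K) 0 (Matrix.specialUnitaryGroup (Fin 2) ℂ),
      (∀ c, V₀ (D.w c) ∈ D.T c z) → ∀ j, j ≤ K - J → ∀ p : Plaq (F.P K) j,
        dist1 (GaugeField.plaqHol (Averaging.iter (fun i => BlockAveraging.blockAvg (P := F.P K) (j := i) ℰp) j (D.Φ (V₀, z))) p) ≠ θ (K - j))
    (charge : ∀ V ∈ O, (∃ U, descendTo F ℰp J K hJK U = V ∧ U ∈ interior (histGood F ℰp θ K J)) →
      0 < fieldMeasure (F.P K) 0 (Matrix.specialUnitaryGroup (Fin 2) ℂ) {z | D.jac (V, z) ≠ 0 ∧ D.Φ (V, z) ∈ histGood F ℰp θ K J}) :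
    WindowChart F hJK (histGood F ℰp θ K J) O where
  Φ := D.Φ
  jac := D.jac
  bound := bound
  measurable_Φ := D.measurable_Φ
  measurable_jac := D.measurable_jac
  jac_le := jac_le
  descendTo_Φ V _ z h := D.descendTo_Φ V z h
  map_Φ := D.map_Φ
  regular V₀ hV₀ := by
    filter_upwards [edge V₀ hV₀, level V₀ hV₀] with z hz hl
    rcases hz with hint | hout
    · have hT : ∀ c, V₀ (D.w c) ∈ D.T c z := fun c => interior_subset (hint c)
      have hfr : D.Φ (V₀, z) ∉ frontier (histGood F ℰp θ K J) := fun h => by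
        obtain ⟨j, hj, p, hp⟩ := frontier_histGood_subset F hδ' hθ hsmall hJK h
        exact hl hT j hj p hp
      obtain ⟨hΦc, hjc⟩ := D.continuousAt_of_interior V₀ z hint hfr
      exact Or.inl ⟨NNReal.continuous_coe.continuousAt.comp hjc, hΦc, fun _ => hfr⟩
    · exact Or.inr ((D.eventually_eq_zero V₀ z hout).mono fun V h => Or.inl h)
  charge := charge

end ChartDataSec

/-- ★★ The level-avoidance regime is reached for small coupling. [cite: Balaban1985UV3, (28)-(31) p.263] -/
theorem exists_gamma_levelRegime :
    ∀ (L : ℕ) (b₀ p₀ : ℝ), 0 < b₀ → 0 < p₀ → ∃ δ' γ₁ : ℝ, 0 < δ' ∧ 0 < γ₁ ∧ ∀ (F : T3Family) (γ : ℝ), F.L = L → 0 < γ → γ ≤ γ₁ →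
      ∀ K : ℕ, (((((F.P K).d + 2) * (F.P K).L : ℕ) : ℝ) ^ 2 / 4) * δ' ≤ ExpMeanLog.deltaSU (Fin 2) / 2 ∧
        ∀ i, θBal F.L γ b₀ p₀ i < δ' := by
  intro L b₀ p₀ hb hp
  set δ' : ℝ := ExpMeanLog.deltaSU (Fin 2) / 2 / ((((3 + 2) * L : ℕ) : ℝ) ^ 2 / 4 + 1) with hδdef
  have hD : 0 < ((((3 + 2) * L : ℕ) : ℝ) ^ 2 / 4 + 1) := by positivity
  have hδ' : 0 < δ' := by rw [hδdef]; exact div_pos (half_pos ExpMeanLog.deltaSU_pos) hD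
  obtain ⟨γ₁, hγ₁, hγ₁1, hθ⟩ := exists_gamma_forall_θBal_le (b₀ := b₀) (p₀ := p₀) hb hp (half_pos hδ')
  refine ⟨δ', γ₁, hδ', hγ₁, fun F γ hFL hγ hγγ₁ K => ?_⟩
  have hL : 1 ≤ F.L := F.hL.2.le
  subst hFL
  refine ⟨?_, fun i => (hθ F.L hL γ hγ hγγ₁ i).trans_lt (half_lt_self hδ')⟩
  have hd : (F.P K).d = 3 := T3Family.P_d F K
  have hLL : (F.P K).L = F.L := rfl
  rw [hd, hLL, hδdef, mul_div_assoc', div_le_iff₀ hD]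
  have hq : 0 ≤ ExpMeanLog.deltaSU (Fin 2) / 2 := (half_pos ExpMeanLog.deltaSU_pos).le
  nlinarith [hq]


/-! ## §4e (v11) THE CHART-FREE RE-CUT OF CHART: VOL + EDGE + LEVEL + CHARGE ⇒ `WindowChartsExist` (PROVED assembly; the four defs are F4a's) -/

section ChartFree

open Literature.MathematicalPhysics.QuantumFieldTheory.Balaban1983to89.ExpMeanLog (deltaSU)
open Literature.MathematicalPhysics.QuantumFieldTheory.Balaban1983to89.BlockAveraging (Idx)
open Literature.MathematicalPhysics.QuantumFieldTheory.Balaban1983to89.BlockAveragingEMLHaarAC (offCard offCard_lt_card)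

/-- The sharp small-field class `{V | PlaqSmall δ V}` of `SU(2)`-configurations is open (finitely many strict … [cite: Balaban1987RG1, (0.18) p.255] -/
theorem isOpen_setOf_plaqSmall₂ (P : Params) (j : ℕ) (δ : ℝ) :
    IsOpen {V : GaugeField P j (Matrix.specialUnitaryGroup (Fin 2) ℂ) | PlaqSmall δ V} := by
  have hdist : ∀ p : Plaq P j, Continuous fun U : GaugeField P j (Matrix.specialUnitaryGroup (Fin 2) ℂ) => dist1 (GaugeField.plaqHol U p) := fun p =>
    (UnitaryModel.continuous_opDist1.comp (Literature.MathematicalPhysics.QuantumLattice.continuous_fundamentalRep (Fin 2))).comp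
      (B12ContinuousTransportInvarianceOn.continuous_plaqHol_SU (N := 2) p)
  simp only [PlaqSmall, setOf_forall]
  exact isOpen_iInter_of_finite fun p => isOpen_lt (hdist p) continuous_const

/-- `#Idx(F.P K) = 36·L³` (`Idx = (Fin d → Fin L) × Perm(Fin d) × Perm(Fin d)`, `d = 3`). [cite: Balaban1985Averaging, (10) p.19 (bookkeeping)] -/
theorem card_Idx_T3 (F : T3Family) (K : ℕ) : Fintype.card (Idx (F.P K)) = F.L ^ 3 * 36 := by
  have h : Fintype.card (Idx (F.P K)) =
      Fintype.card ((Fin (F.P K).d → Fin (F.P K).L) × Equiv.Perm (Fin (F.P K).d) × Equiv.Perm (Fin (F.P K).d)) :=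
    Fintype.card_congr (Equiv.refl _)
  rw [h, Fintype.card_prod, Fintype.card_prod, Fintype.card_fun, Fintype.card_perm, Fintype.card_fin, Fintype.card_fin, T3Family.P_d]
  show F.L ^ 3 * _ = _
  norm_num [Nat.factorial]

/-- ★ The chart regime is non-empty: for every `L ≥ 1` some `α(L) > 0` meets all the numerics. [cite: Balaban1987RG1, (2.9)-(2.10) p.266-267] -/
theorem exists_chartRegime (L : ℕ) (hL : 1 ≤ L) :
    ∃ α : ℝ, 0 < α ∧ α ≤ 1 / 24 ∧ 64 * α ≤ deltaSU (Fin 2) ∧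
      ∀ F : T3Family, F.L = L → ∀ K : ℕ, 157 * α < (((F.P K).L : ℝ) ^ ((F.P K).d - 1))⁻¹ ∧
        ∀ j (c : PBond (F.P K) (j + 1)), (offCard c : ℝ) / (Fintype.card (Idx (F.P K)) : ℝ) + 150 * α < 1 := by
  have hLr : (1 : ℝ) ≤ L := by exact_mod_cast hL
  set C : ℝ := 36 * (L : ℝ) ^ 3 with hC
  have hCpos : 0 < C := by positivity
  set α : ℝ := min (1 / 24) (min (deltaSU (Fin 2) / 64) (min (1 / (158 * (L : ℝ) ^ 2)) (1 / (151 * C)))) with hαdef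
  have hα1 : α ≤ 1 / 24 := min_le_left _ _
  have hα2 : α ≤ deltaSU (Fin 2) / 64 := (min_le_right _ _).trans (min_le_left _ _)
  have hα3 : α ≤ 1 / (158 * (L : ℝ) ^ 2) := (min_le_right _ _).trans ((min_le_right _ _).trans (min_le_left _ _))
  have hα4 : α ≤ 1 / (151 * C) := (min_le_right _ _).trans ((min_le_right _ _).trans (min_le_right _ _))
  have hα0 : 0 < α := by
    rw [hαdef]
    refine lt_min (by norm_num) (lt_min (div_pos ExpMeanLog.deltaSU_pos (by norm_num)) (lt_min (by positivity) (by positivity)))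
  refine ⟨α, hα0, hα1, by linarith, fun F hFL K => ?_⟩
  subst hFL
  have hd : (F.P K).d = 3 := T3Family.P_d F K
  have hLL : (F.P K).L = F.L := rfl
  refine ⟨?_, fun j c => ?_⟩
  · rw [hd, hLL]
    norm_num
    have hx : 0 < ((F.L : ℝ) ^ 2) := by positivity
    rw [inv_eq_one_div, lt_div_iff₀ hx]
    calc 157 * α * (F.L : ℝ) ^ 2 ≤ 157 * (1 / (158 * (F.L : ℝ) ^ 2)) * (F.L : ℝ) ^ 2 := by gcongr
      _ = 157 / 158 := by field_simp
      _ < 1 := by norm_num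
  · have hcard : (Fintype.card (Idx (F.P K)) : ℝ) = C := by
      rw [card_Idx_T3, hC]
      push_cast
      ring
    have hoff : (offCard c : ℝ) + 1 ≤ C := by
      rw [← hcard]
      exact_mod_cast Nat.succ_le_of_lt (offCard_lt_card c)
    rw [hcard]
    have h1 : (offCard c : ℝ) / C ≤ (C - 1) / C := div_le_div_of_nonneg_right (by linarith) hCpos.le
    have h2 : 150 * α ≤ 150 / (151 * C) := by
      calc 150 * α ≤ 150 * (1 / (151 * C)) := by gcongr
        _ = 150 / (151 * C) := by ring
    have h3 : (C - 1) / C + 150 / (151 * C) = 1 - 1 / (151 * C) := by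
      field_simp
      ring
    have h4 : 0 < 1 / (151 * C) := by positivity
    linarith

/-- ★★★ **THE ASSEMBLY (PROVED)**: VOL + EDGE + LEVEL + CHARGE ⇒ window charts exist. [cite: Balaban1987RG1, (2.10) p.267] -/
theorem windowChartsExist_of_flat (hV : ChartVolT3) (hE : EdgeFlat) (hLv : LevelFlat) (hC : ChartCharge) : WindowChartsExist := by
  intro L b₀ p₀ hb hp
  by_cases hL : 1 ≤ L
  swap
  · refine ⟨1, one_pos, fun F γ hFL _ _ => ?_⟩
    exact absurd (hFL ▸ F.hL.2.le) hL
  obtain ⟨δ', γ₁, hδ', hγ₁, hreg⟩ := exists_gamma_levelRegime L b₀ p₀ hb hp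
  obtain ⟨α, hα0, hα24, hα64, hαF⟩ := exists_chartRegime L hL
  set D₅ : ℝ := ((((3 + 2) * L : ℕ) : ℝ) ^ 2 / 4) with hD₅
  have hD₅0 : 0 ≤ D₅ := by positivity
  set σ : ℝ := α / (D₅ + 1) with hσ
  have hσ0 : 0 < σ := div_pos hα0 (by positivity)
  obtain ⟨γ₂, hγ₂, hγ₂1, hθσ⟩ := exists_gamma_forall_θBal_le (b₀ := b₀) (p₀ := p₀) hb hp hσ0
  refine ⟨min γ₁ γ₂, lt_min hγ₁ hγ₂, fun F γ hFL hγ hγle J K hJK V₀ hV₀ => ?_⟩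
  have hLF : 1 ≤ F.L := F.hL.2.le
  obtain ⟨hαL, hgap⟩ := hαF F hFL K
  obtain ⟨hsmall, hθlt⟩ := hreg F γ hFL hγ (hγle.trans (min_le_left _ _)) K
  have hγ1 : γ ≤ 1 := (hγle.trans (min_le_right _ _)).trans hγ₂1
  have hθpos : ∀ i, 0 < θBal F.L γ b₀ p₀ i := fun i => T3MinimiserStabilityReduction.θBal_pos hLF hγ hγ1 hb p₀ i
  have hθ0 : ∀ i, 0 ≤ θBal F.L γ b₀ p₀ i := fun i => (hθpos i).le
  have hθα : ∀ i, (((((F.P K).d + 2) * (F.P K).L : ℕ) : ℝ) ^ 2 / 4) * θBal F.L γ b₀ p₀ i ≤ α := by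
    intro i
    have hθi : θBal F.L γ b₀ p₀ i ≤ σ := hθσ F.L hLF γ hγ (hγle.trans (min_le_right _ _)) i
    have hd : (F.P K).d = 3 := T3Family.P_d F K
    have hLL : (F.P K).L = L := hFL
    rw [hd, hLL, ← hD₅]
    calc D₅ * θBal F.L γ b₀ p₀ i ≤ D₅ * σ := mul_le_mul_of_nonneg_left hθi hD₅0
      _ ≤ α := by
          rw [hσ, mul_div_assoc', div_le_iff₀ (by positivity)]
          nlinarith [hα0.le]
  have hn : K - J ≤ (F.P K).m + (F.P K).K := by
    show K - J ≤ F.m + K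
    omega
  have hβ := iterCentralBond_injective (P := F.P K) (n := K - J) hn
  set θ := θBal F.L γ b₀ p₀ with hθdef
  set O : Set (GaugeField (F.P J) 0 (Matrix.specialUnitaryGroup (Fin 2) ℂ)) := {V | PlaqSmall (θ J) V} with hOdef
  have hO : IsOpen O := isOpen_setOf_plaqSmall₂ (F.P J) 0 (θ J)
  refine ⟨O, hO, hV₀, ?_⟩
  obtain ⟨j₀, hj₀, hvol⟩ := hV F K α hα0 hα24 hα64 hαL hgap
  obtain ⟨D, hDb⟩ := exists_chartData_bdd F hJK hθ0 hα0.le hα24 hα64 hαL hgap hθα hj₀ hvol hO.measurableSet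
  have hs := F.sitesPerDir_eq (m := F.m) (K := J) (j := 0) (m' := F.m) (K' := K) (j' := K - J) (by omega)
  have hdesc : (descendTo F ℰp J K hJK : GaugeField (F.P K) 0 (Matrix.specialUnitaryGroup (Fin 2) ℂ) → GaugeField (F.P J) 0 _) =
      fieldShift hs ∘ Averaging.iter (fun i => BlockAveraging.blockAvg (P := F.P K) (j := i) ℰp) (K - J) := rfl
  have he'e : ∀ y : GaugeField (F.P K) (K - J) (Matrix.specialUnitaryGroup (Fin 2) ℂ), fieldShift hs.symm (fieldShift hs y) = y :=
    fieldShift_fieldShift_symm hs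
  have hee' : ∀ y' : GaugeField (F.P J) 0 (Matrix.specialUnitaryGroup (Fin 2) ℂ), fieldShift hs (fieldShift hs.symm y') = y' :=
    fieldShift_symm_fieldShift hs
  have hiter_of_desc : ∀ U V, descendTo F ℰp J K hJK U = V →
      Averaging.iter (fun i => BlockAveraging.blockAvg (P := F.P K) (j := i) ℰp) (K - J) U = fieldShift hs.symm V := by
    intro U V h
    rw [hdesc, Function.comp_apply] at h
    rw [← h, he'e]
  refine ⟨WindowChart.ofChartData D hδ'.le hθlt hsmall _ hDb (fun V₁ _ => ?edge) (fun V₁ hV₁ => ?level) (fun V₁ _ hpre => ?charge)⟩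
  case edge =>
    have hae : ∀ c, ∀ᵐ z ∂fieldMeasure (F.P K) 0 (Matrix.specialUnitaryGroup (Fin 2) ℂ),
        V₁ (D.w c) ∉ frontier (chainMap ℰp (K - J) z c '' chainWindow (N := 2) α (K - J) z c) := fun c =>
      hE F K (K - J) hn α hα0 hα24 hα64 hαL hgap c (V₁ (D.w c))
    filter_upwards [ae_all_iff.2 hae] with z hz
    by_cases hT : ∀ c, V₁ (D.w c) ∈ D.T c z
    · refine Or.inl fun c => ?_
      rw [← self_sdiff_frontier]
      refine ⟨hT c, ?_⟩
      rw [D.T_eq]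
      exact hz c
    · simp only [not_forall] at hT
      obtain ⟨c, hc⟩ := hT
      exact Or.inr ⟨c, by rwa [(D.isClosed_T c z).closure_eq]⟩
  case level =>
    have hae := hLv F K (K - J) hn α hα0 hα24 hα64 hαL hgap (fun j => θ (K - j)) (fun j => (hθpos _).ne') (fieldShift hs.symm V₁)
    filter_upwards [hae] with z hz hT j hj p
    obtain ⟨hoff, hwin, hd⟩ := D.charted V₁ z hT
    have h2 := hiter_of_desc _ _ hd
    rcases hj.lt_or_eq with hlt | rfl
    · exact hz (D.Φ (V₁, z)) hoff hwin h2 j hlt p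
    · rw [h2, Nat.sub_sub_self hJK]
      exact (lt_of_eq_of_lt (congrArg dist1 (plaqHol_fieldShift hs.symm V₁ p)) (hV₁ _)).ne
  case charge =>
    obtain ⟨U₀, hU₀V, hU₀int⟩ := hpre
    have hW := hiter_of_desc _ _ hU₀V
    have hpos := hC F K J θ α hθ0 hα0 hα24 hα64 hαL hgap hθα (fieldShift hs.symm V₁) ⟨U₀, hU₀int, hW⟩
    refine hpos.trans_le (measure_mono ?_)
    rintro z ⟨g, hUgood, hUiter⟩
    have hch : ∀ c, g c ∈ chainWindow (N := 2) α (K - J) z c := fun c => by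
      have h := histGood_subset_charted F hJK hθ0 hθα hUgood c
      rwa [hβ.extend_apply, chainWindow_extend α hn] at h
    have hd : descendTo F ℰp J K hJK (Function.extend (iterCentralBond (K - J)) g z) = V₁ := by
      rw [hdesc, Function.comp_apply, hUiter, hee']
    obtain ⟨hJ, hΦ⟩ := D.recog V₁ z g hch hUgood hd
    exact ⟨hJ, hΦ ▸ hUgood⟩

end ChartFree

end Summit.QuantumFields.YangMills.Theorems.FluctuationComparisonRegPrIntLWregAssembly

end
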